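import Summits.QuantumFields.QCD.Theorems.QuarksAsStableActionCriticalLineDiamagnetismStubTwoStaticGainAux
import Summits.QuantumFields.QCD.Theorems.QuarksAsStableActionCriticalLineDiamagnetismStubFrequencyFactorisation
import Summits.QuantumFields.QCD.Theorems.QuarksAsStableActionCriticalLineDiamagnetismStubFrequencyDiamagnetism
import Summits.QuantumFields.QCD.Theorems.QuarksAsStableActionCriticalLineDiamagnetismStubHeavyFrequencyGain

/-!
# S5 `stub_twoStaticGain` — the gain for doubly static fields on odd tori (crux `stmt-QuantumFields-9734`, line `Sketch`)

Sub-problem context: `Summits/QuantumFields/QCD/Statement.lean`; crux decl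
`Summit.QuantumFields.QCD.Theses.QuarksAsStableAction.CriticalLineDiamagnetism`.  Pure theorem file: the registered stub
`stub_twoStaticGain` of the static route, assembled (`twoStaticGain_of_frequencyStubs`, worker wave 4, inlined in the skeleton
since v22) from the LANDED `stub_frequencyFactorisation` (S2, p145730), `stub_frequencyDiamagnetism` (S3, p144697) and
`stub_heavyFrequencyGain` (S4, p154593, computational through the CellKappa certificate).
-/

noncomputable section

open scoped BigOperators Classical Matrix ComplexConjugate
open Finset
open Literature.MathematicalPhysics.QuantumLattice Literature.MathematicalPhysics.QuantumFieldTheory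

namespace Summit.QuantumFields.QCD.Cruxes.CriticalLineDiamagnetism.ChessboardCellGain

/-- **Assembly of `stub_twoStaticGain`** (the doubly static gain) from the registered statements of
`stub_frequencyFactorisation` (`hF`), `stub_frequencyDiamagnetism` (`hD`) and `stub_heavyFrequencyGain` (`hG`):
split the `L²` frequencies into heavy (`cos ≤ −199/200` on both axes: gain, `hG`) and the rest (diamagnetic, `hD`),
`lift 1 = T`, and count `#heavy ≥ L²/10⁴` for `L ≥ 200`.  Constants `ε = 1/10`, `c' = c/10⁴`, `K = 1`, `C' = max C 0`,
`L₀' = max L₀ 200`. -/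
theorem twoStaticGain_of_frequencyStubs
    (hF : ∀ (L : ℕ) [NeZero L] (A : ZMod L → ZMod L → Fin 4 → Matrix.unitaryGroup (Fin 3) ℂ) (m : ℝ),
    let fD := fun (A : ZMod L → ZMod L → Fin 4 → Matrix.unitaryGroup (Fin 3) ℂ) (m ω₀ ω₁ : ℝ) =>
      Matrix.of fun (p q : (ZMod L × ZMod L) × Fin 3 × Fin 4) =>
        (if p.1 = q.1 ∧ p.2.1 = q.2.1 then
            (((m + 4 - Real.cos ω₀ - Real.cos ω₁ : ℝ) : ℂ) * (1 : Matrix (Fin 4) (Fin 4) ℂ) p.2.2 q.2.2 +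
              Complex.I * (((Real.sin ω₀ : ℝ) : ℂ) * euclideanGamma 0 p.2.2 q.2.2 +
                ((Real.sin ω₁ : ℝ) : ℂ) * euclideanGamma 1 p.2.2 q.2.2))
          else 0) -
          (1 / 2 : ℂ) *
            ((if q.1 = (p.1.1 + 1, p.1.2) then
                ((1 : Matrix (Fin 4) (Fin 4) ℂ) - euclideanGamma 2) p.2.2 q.2.2 *
                  ((if p.1.1 = -1 then (-1 : ℂ) else 1) * (A p.1.1 p.1.2 2 : Matrix (Fin 3) (Fin 3) ℂ) p.2.1 q.2.1)
              else 0) +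
             (if p.1 = (q.1.1 + 1, q.1.2) then
                ((1 : Matrix (Fin 4) (Fin 4) ℂ) + euclideanGamma 2) p.2.2 q.2.2 *
                  ((if q.1.1 = -1 then (-1 : ℂ) else 1) * (star (A q.1.1 q.1.2 2 : Matrix (Fin 3) (Fin 3) ℂ)) p.2.1 q.2.1)
              else 0) +
             (if q.1 = (p.1.1, p.1.2 + 1) then
                ((1 : Matrix (Fin 4) (Fin 4) ℂ) - euclideanGamma 3) p.2.2 q.2.2 *
                  ((if p.1.2 = -1 then (-1 : ℂ) else 1) * (A p.1.1 p.1.2 3 : Matrix (Fin 3) (Fin 3) ℂ) p.2.1 q.2.1)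
              else 0) +
             (if p.1 = (q.1.1, q.1.2 + 1) then
                ((1 : Matrix (Fin 4) (Fin 4) ℂ) + euclideanGamma 3) p.2.2 q.2.2 *
                  ((if q.1.2 = -1 then (-1 : ℂ) else 1) * (star (A q.1.1 q.1.2 3 : Matrix (Fin 3) (Fin 3) ℂ)) p.2.1 q.2.1)
              else 0));
    let lift := fun (A : ZMod L → ZMod L → Fin 4 → Matrix.unitaryGroup (Fin 3) ℂ) (e : Edge 4 L) =>
      if e.2 = 0 ∨ e.2 = 1 then (if e.1 e.2 = -1 then (-1 : Matrix.unitaryGroup (Fin 3) ℂ) else 1)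
      else (if e.1 e.2 = -1 then -(A (e.1 2) (e.1 3) e.2) else A (e.1 2) (e.1 3) e.2);
    (wilsonDirac (unitaryFundamentalRep (Fin 3) ℂ) (lift A) m 1).det =
      ∏ k₀ : Fin L, ∏ k₁ : Fin L,
        (fD A m (Real.pi * (2 * (k₀ : ℕ) + 1) / L) (Real.pi * (2 * (k₁ : ℕ) + 1) / L)).det)
    (hD : ∀ (L : ℕ) [NeZero L], Odd L →
    ∀ (A : ZMod L → ZMod L → Fin 4 → Matrix.unitaryGroup (Fin 3) ℂ) (m : ℝ), -1 < m → ∀ ω₀ ω₁ : ℝ,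
    let fD := fun (A : ZMod L → ZMod L → Fin 4 → Matrix.unitaryGroup (Fin 3) ℂ) (m ω₀ ω₁ : ℝ) =>
      Matrix.of fun (p q : (ZMod L × ZMod L) × Fin 3 × Fin 4) =>
        (if p.1 = q.1 ∧ p.2.1 = q.2.1 then
            (((m + 4 - Real.cos ω₀ - Real.cos ω₁ : ℝ) : ℂ) * (1 : Matrix (Fin 4) (Fin 4) ℂ) p.2.2 q.2.2 +
              Complex.I * (((Real.sin ω₀ : ℝ) : ℂ) * euclideanGamma 0 p.2.2 q.2.2 +
                ((Real.sin ω₁ : ℝ) : ℂ) * euclideanGamma 1 p.2.2 q.2.2))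
          else 0) -
          (1 / 2 : ℂ) *
            ((if q.1 = (p.1.1 + 1, p.1.2) then
                ((1 : Matrix (Fin 4) (Fin 4) ℂ) - euclideanGamma 2) p.2.2 q.2.2 *
                  ((if p.1.1 = -1 then (-1 : ℂ) else 1) * (A p.1.1 p.1.2 2 : Matrix (Fin 3) (Fin 3) ℂ) p.2.1 q.2.1)
              else 0) +
             (if p.1 = (q.1.1 + 1, q.1.2) then
                ((1 : Matrix (Fin 4) (Fin 4) ℂ) + euclideanGamma 2) p.2.2 q.2.2 *
                  ((if q.1.1 = -1 then (-1 : ℂ) else 1) * (star (A q.1.1 q.1.2 2 : Matrix (Fin 3) (Fin 3) ℂ)) p.2.1 q.2.1)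
              else 0) +
             (if q.1 = (p.1.1, p.1.2 + 1) then
                ((1 : Matrix (Fin 4) (Fin 4) ℂ) - euclideanGamma 3) p.2.2 q.2.2 *
                  ((if p.1.2 = -1 then (-1 : ℂ) else 1) * (A p.1.1 p.1.2 3 : Matrix (Fin 3) (Fin 3) ℂ) p.2.1 q.2.1)
              else 0) +
             (if p.1 = (q.1.1, q.1.2 + 1) then
                ((1 : Matrix (Fin 4) (Fin 4) ℂ) + euclideanGamma 3) p.2.2 q.2.2 *
                  ((if q.1.2 = -1 then (-1 : ℂ) else 1) * (star (A q.1.1 q.1.2 3 : Matrix (Fin 3) (Fin 3) ℂ)) p.2.1 q.2.1)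
              else 0));
    ‖(fD A m ω₀ ω₁).det‖ ≤ ‖(fD (fun _ _ _ => 1) m ω₀ ω₁).det‖)
    (hG : ∃ δ c C : ℝ, 0 < δ ∧ 0 < c ∧ ∃ L₀ : ℕ, ∀ (L : ℕ) [NeZero L], Odd L → L₀ ≤ L →
    ∀ (A : ZMod L → ZMod L → Fin 4 → Matrix.unitaryGroup (Fin 3) ℂ) (m : ℝ), |m| ≤ 1 / 10 → ∀ ω₀ ω₁ : ℝ,
    Real.cos ω₀ ≤ -(199 / 200) → Real.cos ω₁ ≤ -(199 / 200) →
    let fD := fun (A : ZMod L → ZMod L → Fin 4 → Matrix.unitaryGroup (Fin 3) ℂ) (m ω₀ ω₁ : ℝ) =>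
      Matrix.of fun (p q : (ZMod L × ZMod L) × Fin 3 × Fin 4) =>
        (if p.1 = q.1 ∧ p.2.1 = q.2.1 then
            (((m + 4 - Real.cos ω₀ - Real.cos ω₁ : ℝ) : ℂ) * (1 : Matrix (Fin 4) (Fin 4) ℂ) p.2.2 q.2.2 +
              Complex.I * (((Real.sin ω₀ : ℝ) : ℂ) * euclideanGamma 0 p.2.2 q.2.2 +
                ((Real.sin ω₁ : ℝ) : ℂ) * euclideanGamma 1 p.2.2 q.2.2))
          else 0) -
          (1 / 2 : ℂ) *
            ((if q.1 = (p.1.1 + 1, p.1.2) then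
                ((1 : Matrix (Fin 4) (Fin 4) ℂ) - euclideanGamma 2) p.2.2 q.2.2 *
                  ((if p.1.1 = -1 then (-1 : ℂ) else 1) * (A p.1.1 p.1.2 2 : Matrix (Fin 3) (Fin 3) ℂ) p.2.1 q.2.1)
              else 0) +
             (if p.1 = (q.1.1 + 1, q.1.2) then
                ((1 : Matrix (Fin 4) (Fin 4) ℂ) + euclideanGamma 2) p.2.2 q.2.2 *
                  ((if q.1.1 = -1 then (-1 : ℂ) else 1) * (star (A q.1.1 q.1.2 2 : Matrix (Fin 3) (Fin 3) ℂ)) p.2.1 q.2.1)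
              else 0) +
             (if q.1 = (p.1.1, p.1.2 + 1) then
                ((1 : Matrix (Fin 4) (Fin 4) ℂ) - euclideanGamma 3) p.2.2 q.2.2 *
                  ((if p.1.2 = -1 then (-1 : ℂ) else 1) * (A p.1.1 p.1.2 3 : Matrix (Fin 3) (Fin 3) ℂ) p.2.1 q.2.1)
              else 0) +
             (if p.1 = (q.1.1, q.1.2 + 1) then
                ((1 : Matrix (Fin 4) (Fin 4) ℂ) + euclideanGamma 3) p.2.2 q.2.2 *
                  ((if q.1.2 = -1 then (-1 : ℂ) else 1) * (star (A q.1.1 q.1.2 3 : Matrix (Fin 3) (Fin 3) ℂ)) p.2.1 q.2.1)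
              else 0));
    let dfc2 := fun (A : ZMod L → ZMod L → Fin 4 → Matrix.unitaryGroup (Fin 3) ℂ) (a b : ZMod L) =>
      3 - ((A a b 2 : Matrix (Fin 3) (Fin 3) ℂ) * (A (a + 1) b 3 : Matrix (Fin 3) (Fin 3) ℂ) *
        star (A a (b + 1) 2 : Matrix (Fin 3) (Fin 3) ℂ) * star (A a b 3 : Matrix (Fin 3) (Fin 3) ℂ)).trace.re;
    ‖(fD A m ω₀ ω₁).det‖ ≤
      Real.exp (1 / (L : ℝ) ^ 2 - c * (∑ ab ∈ (Finset.univ : Finset (ZMod L × ZMod L)).filter (fun ab => dfc2 A ab.1 ab.2 < δ), dfc2 A ab.1 ab.2)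
        + C * (((Finset.univ : Finset (ZMod L × ZMod L)).filter (fun ab => δ ≤ dfc2 A ab.1 ab.2)).card : ℝ)) *
      ‖(fD (fun _ _ _ => 1) m ω₀ ω₁).det‖) :
    ∃ ε δ c K C : ℝ, 0 < ε ∧ 0 < δ ∧ 0 < c ∧ ∃ L₀ : ℕ, ∀ (L : ℕ) [NeZero L], Odd L → L₀ ≤ L →
    ∀ (A : ZMod L → ZMod L → Fin 4 → Matrix.unitaryGroup (Fin 3) ℂ) (m : ℝ), |m| ≤ ε →
    let lift := fun (A : ZMod L → ZMod L → Fin 4 → Matrix.unitaryGroup (Fin 3) ℂ) (e : Edge 4 L) =>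
      if e.2 = 0 ∨ e.2 = 1 then (if e.1 e.2 = -1 then (-1 : Matrix.unitaryGroup (Fin 3) ℂ) else 1)
      else (if e.1 e.2 = -1 then -(A (e.1 2) (e.1 3) e.2) else A (e.1 2) (e.1 3) e.2);
    let T := fun e : Edge 4 L => if e.1 e.2 = -1 then (-1 : Matrix.unitaryGroup (Fin 3) ℂ) else 1;
    let dfc2 := fun (A : ZMod L → ZMod L → Fin 4 → Matrix.unitaryGroup (Fin 3) ℂ) (a b : ZMod L) =>
      3 - ((A a b 2 : Matrix (Fin 3) (Fin 3) ℂ) * (A (a + 1) b 3 : Matrix (Fin 3) (Fin 3) ℂ) *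
        star (A a (b + 1) 2 : Matrix (Fin 3) (Fin 3) ℂ) * star (A a b 3 : Matrix (Fin 3) (Fin 3) ℂ)).trace.re;
    ‖(wilsonDirac (unitaryFundamentalRep (Fin 3) ℂ) (lift A) m 1).det‖ ≤
      Real.exp (K - c * (L : ℝ) ^ 2 * (∑ ab ∈ (Finset.univ : Finset (ZMod L × ZMod L)).filter (fun ab => dfc2 A ab.1 ab.2 < δ), dfc2 A ab.1 ab.2)
        + C * (L : ℝ) ^ 2 * (((Finset.univ : Finset (ZMod L × ZMod L)).filter (fun ab => δ ≤ dfc2 A ab.1 ab.2)).card : ℝ)) *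
      ‖(wilsonDirac (unitaryFundamentalRep (Fin 3) ℂ) T m 1).det‖ :=
  TwoStaticGain.main
    (fun L _ A m => (wilsonDirac (unitaryFundamentalRep (Fin 3) ℂ)
      ((fun (A : ZMod L → ZMod L → Fin 4 → Matrix.unitaryGroup (Fin 3) ℂ) (e : Edge 4 L) =>
        if e.2 = 0 ∨ e.2 = 1 then (if e.1 e.2 = -1 then (-1 : Matrix.unitaryGroup (Fin 3) ℂ) else 1)
        else (if e.1 e.2 = -1 then -(A (e.1 2) (e.1 3) e.2) else A (e.1 2) (e.1 3) e.2)) A) m 1).det)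
    (fun L _ m => (wilsonDirac (unitaryFundamentalRep (Fin 3) ℂ)
      (fun e : Edge 4 L => if e.1 e.2 = -1 then (-1 : Matrix.unitaryGroup (Fin 3) ℂ) else 1) m 1).det)
    (fun L _ A m ω₀ ω₁ => ((fun (A : ZMod L → ZMod L → Fin 4 → Matrix.unitaryGroup (Fin 3) ℂ) (m ω₀ ω₁ : ℝ) =>
      Matrix.of fun (p q : (ZMod L × ZMod L) × Fin 3 × Fin 4) =>
        (if p.1 = q.1 ∧ p.2.1 = q.2.1 then
            (((m + 4 - Real.cos ω₀ - Real.cos ω₁ : ℝ) : ℂ) * (1 : Matrix (Fin 4) (Fin 4) ℂ) p.2.2 q.2.2 +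
              Complex.I * (((Real.sin ω₀ : ℝ) : ℂ) * euclideanGamma 0 p.2.2 q.2.2 +
                ((Real.sin ω₁ : ℝ) : ℂ) * euclideanGamma 1 p.2.2 q.2.2))
          else 0) -
          (1 / 2 : ℂ) *
            ((if q.1 = (p.1.1 + 1, p.1.2) then
                ((1 : Matrix (Fin 4) (Fin 4) ℂ) - euclideanGamma 2) p.2.2 q.2.2 *
                  ((if p.1.1 = -1 then (-1 : ℂ) else 1) * (A p.1.1 p.1.2 2 : Matrix (Fin 3) (Fin 3) ℂ) p.2.1 q.2.1)
              else 0) +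
             (if p.1 = (q.1.1 + 1, q.1.2) then
                ((1 : Matrix (Fin 4) (Fin 4) ℂ) + euclideanGamma 2) p.2.2 q.2.2 *
                  ((if q.1.1 = -1 then (-1 : ℂ) else 1) * (star (A q.1.1 q.1.2 2 : Matrix (Fin 3) (Fin 3) ℂ)) p.2.1 q.2.1)
              else 0) +
             (if q.1 = (p.1.1, p.1.2 + 1) then
                ((1 : Matrix (Fin 4) (Fin 4) ℂ) - euclideanGamma 3) p.2.2 q.2.2 *
                  ((if p.1.2 = -1 then (-1 : ℂ) else 1) * (A p.1.1 p.1.2 3 : Matrix (Fin 3) (Fin 3) ℂ) p.2.1 q.2.1)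
              else 0) +
             (if p.1 = (q.1.1, q.1.2 + 1) then
                ((1 : Matrix (Fin 4) (Fin 4) ℂ) + euclideanGamma 3) p.2.2 q.2.2 *
                  ((if q.1.2 = -1 then (-1 : ℂ) else 1) * (star (A q.1.1 q.1.2 3 : Matrix (Fin 3) (Fin 3) ℂ)) p.2.1 q.2.1)
              else 0))) A m ω₀ ω₁).det)
    (fun L A a b => 3 - ((A a b 2 : Matrix (Fin 3) (Fin 3) ℂ) * (A (a + 1) b 3 : Matrix (Fin 3) (Fin 3) ℂ) *
      star (A a (b + 1) 2 : Matrix (Fin 3) (Fin 3) ℂ) * star (A a b 3 : Matrix (Fin 3) (Fin 3) ℂ)).trace.re)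
    (fun L _ m => by simp only [ite_self]) hF hD hG


/-- **S5 `stub_twoStaticGain`** — the DOUBLY STATIC GAIN: for a 2D `U(3)` field lifted statically (antiperiodic pattern on the
`0,1`-links), the Wilson determinant on the odd four-torus gains `c·L²` per unit of good `(2,3)`-deficit and pays `C·L²` per bad
plaquette. Assembly (worker): `stub_frequencyFactorisation` (product over the `L²` frequencies, also for the free field `lift 1 = T`),
`stub_frequencyDiamagnetism` at the light frequencies, `stub_heavyFrequencyGain` at the heavy ones, and the count
`#{k : cos(π(2k+1)/L) ≤ −7/10}² ≥ L²/40` for `L ≥ L₀`. [difficulty: M] -/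
theorem stub_twoStaticGain : ∃ ε δ c K C : ℝ, 0 < ε ∧ 0 < δ ∧ 0 < c ∧ ∃ L₀ : ℕ, ∀ (L : ℕ) [NeZero L], Odd L → L₀ ≤ L →
    ∀ (A : ZMod L → ZMod L → Fin 4 → Matrix.unitaryGroup (Fin 3) ℂ) (m : ℝ), |m| ≤ ε →
    let lift := fun (A : ZMod L → ZMod L → Fin 4 → Matrix.unitaryGroup (Fin 3) ℂ) (e : Edge 4 L) =>
      if e.2 = 0 ∨ e.2 = 1 then (if e.1 e.2 = -1 then (-1 : Matrix.unitaryGroup (Fin 3) ℂ) else 1)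
      else (if e.1 e.2 = -1 then -(A (e.1 2) (e.1 3) e.2) else A (e.1 2) (e.1 3) e.2);
    let T := fun e : Edge 4 L => if e.1 e.2 = -1 then (-1 : Matrix.unitaryGroup (Fin 3) ℂ) else 1;
    let dfc2 := fun (A : ZMod L → ZMod L → Fin 4 → Matrix.unitaryGroup (Fin 3) ℂ) (a b : ZMod L) =>
      3 - ((A a b 2 : Matrix (Fin 3) (Fin 3) ℂ) * (A (a + 1) b 3 : Matrix (Fin 3) (Fin 3) ℂ) *
        star (A a (b + 1) 2 : Matrix (Fin 3) (Fin 3) ℂ) * star (A a b 3 : Matrix (Fin 3) (Fin 3) ℂ)).trace.re;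
    ‖(wilsonDirac (unitaryFundamentalRep (Fin 3) ℂ) (lift A) m 1).det‖ ≤
      Real.exp (K - c * (L : ℝ) ^ 2 * (∑ ab ∈ (Finset.univ : Finset (ZMod L × ZMod L)).filter (fun ab => dfc2 A ab.1 ab.2 < δ), dfc2 A ab.1 ab.2)
        + C * (L : ℝ) ^ 2 * (((Finset.univ : Finset (ZMod L × ZMod L)).filter (fun ab => δ ≤ dfc2 A ab.1 ab.2)).card : ℝ)) *
      ‖(wilsonDirac (unitaryFundamentalRep (Fin 3) ℂ) T m 1).det‖ := by
  classical
  exact twoStaticGain_of_frequencyStubs stub_frequencyFactorisation stub_frequencyDiamagnetism stub_heavyFrequencyGain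


end Summit.QuantumFields.QCD.Cruxes.CriticalLineDiamagnetism.ChessboardCellGain
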